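import Mathlib
import HarnessLib
import Summits.Ventures.LatticeQCDFlow.Exactness.NCMCGeneralSpaceReplicaJackknifeDeltaMethod

/-!
# The delete-one-block jackknife of a POOLED ROOT ESTIMATE (monotone estimating equation, e.g. the pooled BAR root of `twosided.bar_jackknife`): coverage `→ L_R(q)` from the score CLT and slope consistency

HONEST FRAMING: exact (Metropolis-corrected) sampling algorithms for lattice gauge theory;
figures of merit are autocorrelation/cost numbers at stated couplings and volumes; no
continuum-physics claim.

Venture `LatticeQCDFlow` (cell pub-lqcd), topic `Exactness`; FANOUT row 13 (`eng-snf`, GEN-25).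
NEW WORK of the cell (elementary asymptotic statistics) on top of GEN-25's
`NCMCGeneralSpaceReplicaJackknifeDeltaMethod` (the perturbed replica-`t` lemma and the jackknife
algebra); not a published result; no definition; nothing cited as a fact.

WHY (row 13). `latflow-snf`'s `twosided.bar_jackknife(W_f, W_r, blocks_f, blocks_r)` prints the
Bennett-acceptance-ratio estimate of the POOLED forward/reverse samples (the root `d̂` of the
monotone sample equation `Σ_i σ(d − W_{f,i}) = Σ_j σ(W_{r,j} + d)` with `M = 0`) together with its
delete-one-PAIRED-block jackknife error (block `g` removes forward block `g` and reverse block `g`;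
replicates = pooled roots leaving one block pair out; `estimators.jackknife` algebra). A root is not
a function of pooled means, so GEN-25's `…JackknifeDeltaMethod` / `…Ratio` / `…FDeriv` do not apply
verbatim. But EXACTLY, for every block set `S`: `√n (d̂_S − θ) = −v̄_S / D_S`, with `v̄_S` the mean
over `r ∈ S` of the scaled per-block SCORE means `v_r = √n · (1/n) Σ_{i ∈ block r} ψ_θ(record i)`
(`ψ_θ` the estimating function at the true parameter, `E ψ_θ = 0`) and `D_S` the secant SLOPE of the
pooled sample equation between `θ` and `d̂_S` (a random number; for a smooth monotone equation `D_S
→` the population slope `κ ≠ 0` in probability as soon as `d̂_S → θ`). So the jackknife-studentised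
deviation is a FIXED function `Ψ(v, D)` of the score vector and the finitely many slopes, continuous
at `(z, κ)` off the diagonal with value `−sign(κ)·t(z)`, and GEN-25's perturbed replica-`t` lemma
gives: **if `(v_r)_r ⇒ N(0, σ²)^{⊗R}` and `D_S → κ ≠ 0` in probability for `S = univ` and every
`univ ∖ {r}`, then for every bias-correction weight `κ'` and every `q ≥ 0` the coverage of the
pooled-root jackknife bar tends to `L_R(q) = N(0,1)^{⊗R}{|t| ≤ q}`.** The hypotheses are exactly
what GEN-15–22's BAR files establish per stream pair (score CLT along the pair restart chain; Taylor
bound with Lipschitz derivative `abs_barSummand_taylor_le` ⇒ `|D_S − mean φ_θ| ≤ ½|d̂_S − θ|`; root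
consistency); the instance is left to a successor (NOT CLAIMED here).

* **`tendsto_measure_abs_pooledRootJackknife_le`** — the abstract theorem (free `κ'`);
  **`…_plain`** (`κ' = 0`).

NOT CLAIMED: the BAR instance (slope consistency and the score CLT for the pooled pair streams);
unequal block lengths; anything numerical.
-/

namespace Summit.Ventures.LatticeQCDFlow.Exactness.GeneralNCMC

open MeasureTheory ProbabilityTheory Filter Finset WithLp
open scoped ENNReal NNReal Topology

section Tools

variable {α : Type*} [Fintype α] {Ω₀ : Type*} [MeasurableSpace Ω₀] {P : Measure Ω₀}

/-- Coordinatewise convergence in probability to a constant is convergence in the sup norm (finitely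
many coordinates).  (Private copy of `NCMCGeneralSpaceReplicaJackknifeRatio`'s lemma, which is not
imported here.) -/
private theorem tendstoInMeasure_pi_const_of_forall_aux {Y : ℕ → Ω₀ → α → ℝ} {b : α → ℝ}
    (h : ∀ r, TendstoInMeasure P (fun n ω => Y n ω r) atTop (fun _ => b r)) :
    TendstoInMeasure P Y atTop (fun _ => b) := by
  rw [tendstoInMeasure_iff_norm]
  intro ε hε
  have hsub : ∀ n, {ω | ε ≤ ‖Y n ω - b‖} ⊆ ⋃ r, {ω | ε ≤ ‖Y n ω r - b r‖} := by
    intro n ω hω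
    by_contra hall
    simp only [Set.mem_iUnion, Set.mem_setOf_eq, not_exists, not_le] at hall
    exact absurd ((pi_norm_lt_iff hε).2 fun r => by simpa using hall r) (not_lt.2 hω)
  have hle : ∀ n, P {ω | ε ≤ ‖Y n ω - b‖} ≤ ∑ r, P {ω | ε ≤ ‖Y n ω r - b r‖} :=
    fun n => (measure_mono (hsub n)).trans (measure_iUnion_fintype_le _ _)
  have hsum : Tendsto (fun n => ∑ r, P {ω | ε ≤ ‖Y n ω r - b r‖}) atTop (𝓝 0) := by
    rw [← Finset.sum_const_zero]
    exact tendsto_finsetSum _ fun r _ => (tendstoInMeasure_iff_norm.1 (h r)) ε hε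
  exact tendsto_of_tendsto_of_tendsto_of_le_of_le' tendsto_const_nhds hsum
    (Eventually.of_forall fun n => bot_le) (Eventually.of_forall hle)

end Tools

section Root

variable {ι : Type*} [Fintype ι] [DecidableEq ι] [Nontrivial ι]
  {Ω₀ : Type*} [MeasurableSpace Ω₀] {P : Measure Ω₀} [IsProbabilityMeasure P]

/-- **THE POOLED-ROOT JACKKNIFE BAR COVERS WITH PROBABILITY `→ L_R(q)`.**  Scaled per-block score
means `V_n : Ω → (ι → ℝ)` with `(V_{n,r})_r ⇒ N(0, v)^{⊗R}` (`v ≠ 0`, `R = card ι ≥ 2`); pooled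
estimates `d_n ω S` for the block sets `S` (used at `S = univ` and `S = univ ∖ {r}`) and measurable
slopes `D_n ω S` with `D_{n,S} → κ ≠ 0` in probability, tied by the exact identities
`√n (d_n ω univ − θ) = −((Σ_r V_{n,r})/R) / D_n ω univ` and
`√n (d_n ω (univ∖{t}) − θ) = −((Σ_{r≠t} V_{n,r})/(R−1)) / D_n ω (univ∖{t})` for `n ≥ 1`.  Then for
every `κ'` and `q ≥ 0` the probability that
`|d(univ) + κ'(d(univ) − m) − θ| ≤ q·√(((R−1)/R) Σ_r (d(univ∖{r}) − m)²)`,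
`m = (1/R)Σ_t d(univ∖{t})`
(as the studentised ratio), tends to `N(0,1)^{⊗R}{|t| ≤ q}`. -/
theorem tendsto_measure_abs_pooledRootJackknife_le {V : ℕ → Ω₀ → ι → ℝ}
    {d D : ℕ → Ω₀ → Finset ι → ℝ} (hDm : ∀ n S, Measurable fun ω => D n ω S)
    {θ κ : ℝ} (hκ : κ ≠ 0) {v : ℝ≥0} (hv : v ≠ 0)
    (hV : TendstoInDistribution (fun (n : ℕ) ω => toLp 2 (V n ω)) atTop (toLp 2) (fun _ => P)
      (Measure.pi fun _ : ι => gaussianReal 0 v))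
    (hD : ∀ S : Finset ι, TendstoInMeasure P (fun n ω => D n ω S) atTop (fun _ => κ))
    (hfull : ∀ (n : ℕ) ω, 0 < n → Real.sqrt (n : ℝ) * (d n ω univ - θ)
      = -((∑ r, V n ω r) / Fintype.card ι) / D n ω univ)
    (hloo : ∀ (n : ℕ) ω t, 0 < n → Real.sqrt (n : ℝ) * (d n ω (univ.erase t) - θ)
      = -((∑ r ∈ univ.erase t, V n ω r) / ((Fintype.card ι : ℝ) - 1)) / D n ω (univ.erase t))
    (κ' : ℝ) {q : ℝ} (hq : 0 ≤ q) :
    Tendsto (fun n => P {ω |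
      |(d n ω univ + κ' * (d n ω univ - (∑ t, d n ω (univ.erase t)) / Fintype.card ι) - θ)
        / Real.sqrt (((Fintype.card ι : ℝ) - 1) / Fintype.card ι
          * ∑ r, (d n ω (univ.erase r) - (∑ t, d n ω (univ.erase t)) / Fintype.card ι) ^ 2)| ≤ q})
      atTop
      (𝓝 ((Measure.pi fun _ : ι => gaussianReal 0 1) {z : ι → ℝ | |(∑ r, z r) / Fintype.card ι
        / Real.sqrt ((∑ r, (z r - (∑ r', z r') / Fintype.card ι) ^ 2)
            / ((Fintype.card ι : ℝ) * (Fintype.card ι - 1)))| ≤ q})) := by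
  have hR2 : (2 : ℝ) ≤ Fintype.card ι := by
    exact_mod_cast (Fintype.one_lt_card : 2 ≤ Fintype.card ι)
  have hR0 : (Fintype.card ι : ℝ) ≠ 0 := by positivity
  have hR1 : (Fintype.card ι : ℝ) - 1 ≠ 0 := by linarith
  have hRpos : (0 : ℝ) < (Fintype.card ι : ℝ) * (Fintype.card ι - 1) :=
    mul_pos (by linarith) (by linarith)
  set P' : Measure (ι → ℝ) := Measure.pi fun _ : ι => gaussianReal 0 v with hP'
  -- the scale-free function of (score vector, slopes)
  set Ψ : PiLp 2 (fun _ : ι => ℝ) × (Finset ι → ℝ) → ℝ := fun p =>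
    (-((∑ r, p.1 r) / Fintype.card ι) / p.2 univ
        + κ' * (-((∑ r, p.1 r) / Fintype.card ι) / p.2 univ
          - (∑ t, -((∑ r ∈ univ.erase t, p.1 r) / ((Fintype.card ι : ℝ) - 1)) / p.2 (univ.erase t))
              / Fintype.card ι))
      / Real.sqrt (((Fintype.card ι : ℝ) - 1) / Fintype.card ι
        * ∑ r, (-((∑ u ∈ univ.erase r, p.1 u) / ((Fintype.card ι : ℝ) - 1)) / p.2 (univ.erase r)
          - (∑ t, -((∑ u ∈ univ.erase t, p.1 u) / ((Fintype.card ι : ℝ) - 1)) / p.2 (univ.erase t))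
              / Fintype.card ι) ^ 2) with hΨ
  have hΨm : Measurable Ψ := by rw [hΨ]; fun_prop
  -- the slope vector converges in probability to the constant `κ`
  have hDn : ∀ n, Measurable fun ω => (fun S => D n ω S : Finset ι → ℝ) := fun n =>
    measurable_pi_lambda _ fun S => hDm n S
  have hY : TendstoInMeasure P (fun n ω => (fun S => D n ω S : Finset ι → ℝ)) atTop
      (fun _ => fun _ : Finset ι => κ) :=
    tendstoInMeasure_pi_const_of_forall_aux hD
  -- the value `Ψ(z, κ) = ((−κ⁻¹)/|−κ⁻¹|) · t(z)` for EVERY `z`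
  have hval : ∀ z : ι → ℝ, Ψ (toLp 2 z, fun _ : Finset ι => κ)
      = (-κ⁻¹) / |(-κ⁻¹)| * ((∑ r, z r) / Fintype.card ι
        / Real.sqrt ((∑ r, (z r - (∑ r', z r') / Fintype.card ι) ^ 2)
            / ((Fintype.card ι : ℝ) * (Fintype.card ι - 1)))) := by
    intro z
    have hneg : ∀ x : ℝ, -x / κ = (-κ⁻¹) * x := fun x => by rw [neg_div, div_eq_inv_mul, neg_mul]
    simp only [hΨ, hneg]
    rw [jackknife_variance_const_mul_looMean hR0 hR1 z (-κ⁻¹),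
      sum_const_mul_looMean_div hR1 z (-κ⁻¹), sub_self, mul_zero, add_zero,
      Real.sqrt_mul (sq_nonneg _), Real.sqrt_sq_eq_abs, mul_div_mul_comm]
  -- continuity of `Ψ` at `(z, κ)` off the diagonal
  have hcont : ∀ᵐ z ∂P', ContinuousAt Ψ (toLp 2 z, fun _ : Finset ι => κ) := by
    filter_upwards [ae_sumSqDev_ne_zero_pi_gaussianReal (ι := ι) 0 hv] with z hz
    set p₀ : PiLp 2 (fun _ : ι => ℝ) × (Finset ι → ℝ) := (toLp 2 z, fun _ : Finset ι => κ) with hp₀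
    have hc1 : ∀ (S : Finset ι) (c : ℝ),
        Continuous fun p : PiLp 2 (fun _ : ι => ℝ) × (Finset ι → ℝ) => -((∑ r ∈ S, p.1 r) / c) :=
      fun S c => by fun_prop
    have hc2 : ∀ S : Finset ι, Continuous fun p : PiLp 2 (fun _ : ι => ℝ) × (Finset ι → ℝ) =>
        p.2 S := fun S => by fun_prop
    have hden : ∀ S : Finset ι,
        (fun p : PiLp 2 (fun _ : ι => ℝ) × (Finset ι → ℝ) => p.2 S) p₀ ≠ 0 := fun S => by
      simp only [hp₀]; exact hκ
    have hqS : ∀ (S : Finset ι) (c : ℝ), ContinuousAt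
        (fun p : PiLp 2 (fun _ : ι => ℝ) × (Finset ι → ℝ) => -((∑ r ∈ S, p.1 r) / c) / p.2 S) p₀ :=
      fun S c => (hc1 S c).continuousAt.div (hc2 S).continuousAt (hden S)
    have hq0 := hqS univ (Fintype.card ι : ℝ)
    have hqt : ∀ t, ContinuousAt _ p₀ := fun t => hqS (univ.erase t) ((Fintype.card ι : ℝ) - 1)
    have hS : ContinuousAt (fun p : PiLp 2 (fun _ : ι => ℝ) × (Finset ι → ℝ) =>
        (∑ t, -((∑ r ∈ univ.erase t, p.1 r) / ((Fintype.card ι : ℝ) - 1)) / p.2 (univ.erase t))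
          / (Fintype.card ι : ℝ)) p₀ :=
      (tendsto_finsetSum _ fun t _ => hqt t).div_const _
    have hk0 : -κ⁻¹ ≠ 0 := neg_ne_zero.2 (inv_ne_zero hκ)
    have hJpos : 0 < (-κ⁻¹) ^ 2 * ((∑ r, (z r - (∑ s, z s) / Fintype.card ι) ^ 2)
          / ((Fintype.card ι : ℝ) * (Fintype.card ι - 1))) :=
      mul_pos (by positivity) (div_pos (lt_of_le_of_ne (sum_nonneg fun r _ => sq_nonneg _)
        (Ne.symm hz)) hRpos)
    have hneg : ∀ x : ℝ, -x / κ = (-κ⁻¹) * x := fun x => by rw [neg_div, div_eq_inv_mul, neg_mul]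
    rw [hΨ]
    refine (hq0.add (continuousAt_const.mul (hq0.sub hS))).div
      (Real.continuous_sqrt.continuousAt.comp (continuousAt_const.mul
        (tendsto_finsetSum _ fun r _ => ((hqt r).sub hS).pow 2))) ?_
    simp only [hp₀, PiLp.toLp_apply, hneg]
    rw [jackknife_variance_const_mul_looMean hR0 hR1 z (-κ⁻¹)]
    exact (Real.sqrt_pos.2 hJpos).ne'
  have hσ : |((-κ⁻¹) / |(-κ⁻¹)|)| = 1 := by
    rw [abs_div, abs_abs, div_self (abs_ne_zero.2 (neg_ne_zero.2 (inv_ne_zero hκ)))]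
  refine tendsto_measure_abs_le_of_perturbed_tStat hv hV hY (fun n => (hDn n).aemeasurable) hΨm hσ
    hcont (Eventually.of_forall hval) ?_ hq
  -- the exact `√n`-scaling identity, for `n ≥ 1`
  filter_upwards [eventually_gt_atTop 0] with n hn ω
  have hs : 0 < Real.sqrt (n : ℝ) := Real.sqrt_pos.2 (by exact_mod_cast hn)
  rw [hΨ, studentised_biasCorrected_scale _ θ κ' _ hs]
  simp only [hfull n ω hn, hloo n ω _ hn]

/-- **The plain centre** (`κ' = 0`): coverage of `d(univ) ± q·err` tends to `L_R(q)`. -/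
theorem tendsto_measure_abs_pooledRootJackknife_le_plain {V : ℕ → Ω₀ → ι → ℝ}
    {d D : ℕ → Ω₀ → Finset ι → ℝ} (hDm : ∀ n S, Measurable fun ω => D n ω S)
    {θ κ : ℝ} (hκ : κ ≠ 0) {v : ℝ≥0} (hv : v ≠ 0)
    (hV : TendstoInDistribution (fun (n : ℕ) ω => toLp 2 (V n ω)) atTop (toLp 2) (fun _ => P)
      (Measure.pi fun _ : ι => gaussianReal 0 v))
    (hD : ∀ S : Finset ι, TendstoInMeasure P (fun n ω => D n ω S) atTop (fun _ => κ))
    (hfull : ∀ (n : ℕ) ω, 0 < n → Real.sqrt (n : ℝ) * (d n ω univ - θ)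
      = -((∑ r, V n ω r) / Fintype.card ι) / D n ω univ)
    (hloo : ∀ (n : ℕ) ω t, 0 < n → Real.sqrt (n : ℝ) * (d n ω (univ.erase t) - θ)
      = -((∑ r ∈ univ.erase t, V n ω r) / ((Fintype.card ι : ℝ) - 1)) / D n ω (univ.erase t))
    {q : ℝ} (hq : 0 ≤ q) :
    Tendsto (fun n => P {ω |
      |(d n ω univ - θ)
        / Real.sqrt (((Fintype.card ι : ℝ) - 1) / Fintype.card ι
          * ∑ r, (d n ω (univ.erase r) - (∑ t, d n ω (univ.erase t)) / Fintype.card ι) ^ 2)| ≤ q})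
      atTop
      (𝓝 ((Measure.pi fun _ : ι => gaussianReal 0 1) {z : ι → ℝ | |(∑ r, z r) / Fintype.card ι
        / Real.sqrt ((∑ r, (z r - (∑ r', z r') / Fintype.card ι) ^ 2)
            / ((Fintype.card ι : ℝ) * (Fintype.card ι - 1)))| ≤ q})) := by
  refine (tendsto_measure_abs_pooledRootJackknife_le hDm hκ hv hV hD hfull hloo 0 hq).congr' ?_
  refine Eventually.of_forall fun n => ?_
  simp only [zero_mul, add_zero]

end Root

end Summit.Ventures.LatticeQCDFlow.Exactness.GeneralNCMC
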